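import Literature.NumberTheory.Irrationality.Tosi2026.BasicCellularIntegrals
import Literature.Analysis.SpecialFunctions.SechConvolutionChain
import Mathlib.MeasureTheory.Function.Jacobian
import Mathlib.Analysis.SpecialFunctions.Artanh
import HarnessLib

/-!
# Tosi's basic cellular integrals in hyperbolic coordinates: `ξ_{n+1}` as a `sech`-chain integral

Source of the STATEMENT served here: R. Tosi, *An explicit study of a family of cellular integrals*,
arXiv:2601.00346 [Tosi2026], Theorem 1 (the closed forms of the basic cellular integrals
`ξ_l = ∫_{(0,1)^l} dx/((1 − x₁x₂)(1 − x₂x₃)⋯(1 − x_{l−1}x_l))`, typed as the named fact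
`Literature.NumberTheory.Irrationality.Tosi2026.theorem1` in `BasicCellularIntegrals.lean`).

This file is the first of three giving OUR proof of that theorem (not the paper's route through
hyperlogarithms, the recurrence of its §2.3 and [Hof17]): the substitution `x_i = tanh a_i` turns the
integrand into a product of hyperbolic secants along a path with both ends pinned at `0`,

`1/(1 − tanh a · tanh b) = cosh a cosh b / cosh(a − b)`, `dx = da/cosh² a`, so that
`ξ_{n+1} = ∫_{(0,∞)^{n+1}} sech(a₀) ∏_{i<n} sech(a_i − a_{i+1}) · sech(a_n) da`   (`xi_succ_eq_lintegral_posOrthant`),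

and iterated integration over the WHOLE space collapses the chain onto the convolution powers of
`sech` of `Literature.Analysis.SpecialFunctions.SechConvolutionChain`:

`∫_{ℝ^{n+1}} sech(a₀) ∏_{i<n} sech(a_i − a_{i+1}) · f_k(a_n) da = f_{n+k+1}(0)`   (`lintegral_chainDensity_sechConv`).

The comparison between the positive orthant and the whole space (a factor `1/(n+2)`, by a cyclic
symmetry) is `CyclicSymmetry.lean`; the assembly is `TheoremOneProofs.lean`.

## Contents (all proved; no named facts)

* `posOrthant n`, `chainDensity n g`, `cycleDensity n = chainDensity n sech`; measurability, positivity;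
* `tanhMap`, its derivative `tanhMapDeriv` (diagonal, determinant `∏ sech² a_i`), injectivity, image
  `tanhMap '' posOrthant = box`; `lintegral_box_eq_lintegral_posOrthant` (change of variables, Mathlib's
  `lintegral_image_eq_lintegral_abs_det_fderiv_mul`); the pointwise identity `omegaDensity ∘ tanh · ∏ sech² =
  cycleDensity`; `xi_succ_eq_lintegral_posOrthant`;
* `lintegral_chainDensity_succ` (peeling the last coordinate, Tonelli) and `lintegral_chainDensity_sechConv`.
-/

noncomputable section

open MeasureTheory Set Finset Real
open scoped ENNReal
open Literature.Analysis.SpecialFunctions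

namespace Literature.NumberTheory.Irrationality.Tosi2026

/-! ### The positive orthant and the chain densities -/

/-- The open positive orthant `{a | ∀ i, 0 < a_i}` of `ℝ^{n+1}`. [cite: Tosi2026, Theorem 1 (proof device, ours)] -/
def posOrthant (n : ℕ) : Set (Fin (n + 1) → ℝ) := {a | ∀ i, 0 < a i}

/-- The `sech`-chain density with end weight `g`:
`sech(a₀) · ∏_{i<n} sech(a_i − a_{i+1}) · g(a_n)` on `ℝ^{n+1}`. [cite: Tosi2026, Theorem 1 (proof device, ours)] -/
def chainDensity (n : ℕ) (g : ℝ → ℝ) (a : Fin (n + 1) → ℝ) : ℝ :=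
  sech (a 0) * (∏ i : Fin n, sech (a i.castSucc - a i.succ)) * g (a (Fin.last n))

/-- The pinned-cycle density `sech(a₀) ∏_{i<n} sech(a_i − a_{i+1}) sech(a_n)`: the product of `sech` over
the edges of an `(n+2)`-cycle whose extra vertex carries the value `0`. [cite: Tosi2026, Theorem 1 (proof device, ours)] -/
def cycleDensity (n : ℕ) : (Fin (n + 1) → ℝ) → ℝ := chainDensity n sech

/-- `posOrthant` is a product set. [cite: Tosi2026, Theorem 1 (proof device, ours)] -/
theorem posOrthant_eq_pi (n : ℕ) : posOrthant n = Set.pi univ fun _ => Ioi (0 : ℝ) := by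
  ext a; simp [posOrthant]

/-- `posOrthant` is measurable. [cite: Tosi2026, Theorem 1 (proof device, ours)] -/
theorem measurableSet_posOrthant (n : ℕ) : MeasurableSet (posOrthant n) := by
  rw [posOrthant_eq_pi]
  exact MeasurableSet.univ_pi fun _ => measurableSet_Ioi

/-- `box` is a product set. [cite: Tosi2026, §2.2 p. 17 (`Δ_l = [0,1]^l`)] -/
theorem box_eq_pi (l : ℕ) : box l = Set.pi univ fun _ => Ioo (0 : ℝ) 1 := by
  ext x; simp [box]

/-- Tosi's open box `box (n+1) ⊆ ℝ^{n+1}` is measurable. [cite: Tosi2026, §2.2 p. 17 (`Δ_l = [0,1]^l`)] -/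
theorem measurableSet_box_succ (n : ℕ) : MeasurableSet (box (n + 1)) := by
  rw [box_eq_pi]
  exact MeasurableSet.univ_pi fun _ => measurableSet_Ioo

/-- The chain density is measurable for measurable `g`. [cite: Tosi2026, Theorem 1 (proof device, ours)] -/
theorem measurable_chainDensity (n : ℕ) {g : ℝ → ℝ} (hg : Measurable g) :
    Measurable (chainDensity n g) := by
  unfold chainDensity
  refine Measurable.mul (Measurable.mul ?_ ?_) (hg.comp (measurable_pi_apply _))
  · exact continuous_sech.measurable.comp (measurable_pi_apply 0)
  · refine Finset.measurable_prod _ fun i _ => ?_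
    exact continuous_sech.measurable.comp ((measurable_pi_apply _).sub (measurable_pi_apply _))

/-- The chain density is nonnegative for `g ≥ 0`. [cite: Tosi2026, Theorem 1 (proof device, ours)] -/
theorem chainDensity_nonneg (n : ℕ) {g : ℝ → ℝ} (hg : ∀ t, 0 ≤ g t) (a : Fin (n + 1) → ℝ) :
    0 ≤ chainDensity n g a :=
  mul_nonneg (mul_nonneg (sech_pos _).le (prod_nonneg fun _ _ => (sech_pos _).le)) (hg _)

/-- The cycle density is measurable. [cite: Tosi2026, Theorem 1 (proof device, ours)] -/
theorem measurable_cycleDensity (n : ℕ) : Measurable (cycleDensity n) :=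
  measurable_chainDensity n continuous_sech.measurable

/-- The cycle density is positive. [cite: Tosi2026, Theorem 1 (proof device, ours)] -/
theorem cycleDensity_pos (n : ℕ) (a : Fin (n + 1) → ℝ) : 0 < cycleDensity n a :=
  mul_pos (mul_pos (sech_pos _) (prod_pos fun _ _ => sech_pos _)) (sech_pos _)

/-! ### The substitution `x = tanh a` -/

/-- `Φ(a)_i = tanh a_i`. [cite: Tosi2026, Theorem 1 (proof device, ours)] -/
def tanhMap (n : ℕ) (a : Fin (n + 1) → ℝ) : Fin (n + 1) → ℝ := fun i => Real.tanh (a i)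

/-- The derivative of `Φ`: the diagonal map with entries `sech² a_i`. [cite: Tosi2026, Theorem 1 (proof device, ours)] -/
def tanhMapDeriv (n : ℕ) (a : Fin (n + 1) → ℝ) : (Fin (n + 1) → ℝ) →L[ℝ] (Fin (n + 1) → ℝ) :=
  ContinuousLinearMap.pi fun i => (sech (a i) ^ 2) • ContinuousLinearMap.proj i

/-- `Φ` has derivative `tanhMapDeriv`. [cite: Tosi2026, Theorem 1 (proof device, ours)] -/
theorem hasFDerivAt_tanhMap (n : ℕ) (a : Fin (n + 1) → ℝ) :
    HasFDerivAt (tanhMap n) (tanhMapDeriv n a) a := by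
  unfold tanhMap tanhMapDeriv
  refine hasFDerivAt_pi.mpr fun i => ?_
  exact (hasDerivAt_tanh (a i)).comp_hasFDerivAt a
    (ContinuousLinearMap.proj (R := ℝ) (φ := fun _ : Fin (n + 1) => ℝ) i).hasFDerivAt

/-- The derivative acts diagonally: `(DΦ(a) v)_i = sech²(a_i) v_i`. [cite: Tosi2026, Theorem 1 (proof device, ours)] -/
theorem tanhMapDeriv_apply (n : ℕ) (a v : Fin (n + 1) → ℝ) (i : Fin (n + 1)) :
    tanhMapDeriv n a v i = sech (a i) ^ 2 * v i := by
  simp [tanhMapDeriv]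

/-- `det DΦ(a) = ∏ sech²(a_i)`. [cite: Tosi2026, Theorem 1 (proof device, ours)] -/
theorem det_tanhMapDeriv (n : ℕ) (a : Fin (n + 1) → ℝ) :
    (tanhMapDeriv n a).det = ∏ i, sech (a i) ^ 2 := by
  have hM : LinearMap.toMatrix' ((tanhMapDeriv n a : (Fin (n + 1) → ℝ) →L[ℝ] (Fin (n + 1) → ℝ)) :
      (Fin (n + 1) → ℝ) →ₗ[ℝ] (Fin (n + 1) → ℝ)) = Matrix.diagonal fun i => sech (a i) ^ 2 := by
    ext i j
    rw [LinearMap.toMatrix'_apply, ContinuousLinearMap.coe_coe, tanhMapDeriv_apply, Matrix.diagonal_apply]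
    by_cases h : i = j
    · subst h; simp
    · simp [h]
  rw [ContinuousLinearMap.det, ← LinearMap.det_toMatrix', hM, Matrix.det_diagonal]

/-- `Φ` is injective. [cite: Tosi2026, Theorem 1 (proof device, ours)] -/
theorem tanhMap_injective (n : ℕ) : Function.Injective (tanhMap n) := by
  intro a b h
  funext i
  exact Real.tanh_injective (congr_fun h i)

/-- `tanh a ∈ (0,1)` for `a > 0`. [cite: Tosi2026, Theorem 1 (proof device, ours)] -/
theorem tanh_mem_Ioo {a : ℝ} (ha : 0 < a) : Real.tanh a ∈ Ioo (0 : ℝ) 1 := by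
  refine ⟨?_, Real.tanh_lt_one a⟩
  rw [Real.tanh_eq_sinh_div_cosh]
  exact div_pos (Real.sinh_pos_iff.mpr ha) (Real.cosh_pos a)

/-- `Φ` maps the positive orthant onto the open unit box. [cite: Tosi2026, Theorem 1 (proof device, ours)] -/
theorem tanhMap_image (n : ℕ) : tanhMap n '' posOrthant n = box (n + 1) := by
  ext x
  constructor
  · rintro ⟨a, ha, rfl⟩ i
    exact tanh_mem_Ioo (ha i)
  · intro hx
    refine ⟨fun i => Real.artanh (x i), fun i => Real.artanh_pos (hx i), ?_⟩
    funext i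
    have hi := hx i
    exact Real.tanh_artanh ⟨by linarith [hi.1], hi.2⟩

/-- **Change of variables** `x = tanh a` for nonnegative integrands on the box:
`∫_{box} G = ∫_{(0,∞)^{n+1}} ∏ sech²(a_i) · G(tanh a) da`. [cite: Tosi2026, Theorem 1 (proof device, ours)] -/
theorem lintegral_box_eq_lintegral_posOrthant (n : ℕ) (G : (Fin (n + 1) → ℝ) → ℝ≥0∞) :
    ∫⁻ x in box (n + 1), G x =
      ∫⁻ a in posOrthant n, ENNReal.ofReal (∏ i, sech (a i) ^ 2) * G (tanhMap n a) := by
  rw [← tanhMap_image]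
  rw [lintegral_image_eq_lintegral_abs_det_fderiv_mul volume (measurableSet_posOrthant n)
    (fun a _ => (hasFDerivAt_tanhMap n a).hasFDerivWithinAt) (tanhMap_injective n).injOn G]
  refine setLIntegral_congr_fun (measurableSet_posOrthant n) (fun a _ => ?_)
  rw [det_tanhMapDeriv, abs_of_nonneg (prod_nonneg fun i _ => sq_nonneg _)]

/-! ### The integrand in the new coordinates -/

/-- For `l = n+1` the integrand is `∏_{i<n} 1/(1 − x_i x_{i+1})` (the last factor of the `Fin (n+1)`-indexed
product is `1`). [cite: Tosi2026, Introduction p. 2 (definition of `ξ_l`)] -/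
theorem omegaDensity_succ (n : ℕ) (x : Fin (n + 1) → ℝ) :
    omegaDensity (n + 1) x = ∏ i : Fin n, 1 / (1 - x i.castSucc * x i.succ) := by
  unfold omegaDensity
  rw [Fin.prod_univ_castSucc]
  have hlast : ¬ ((Fin.last n).1 + 1 < n + 1) := by simp
  rw [dif_neg hlast, mul_one]
  refine prod_congr rfl fun i _ => ?_
  have hi : (i.castSucc).1 + 1 < n + 1 := by simp [i.2]
  rw [dif_pos hi]
  congr 3

/-- The key one-variable identity: `1/(1 − tanh u tanh v) = sech(u − v)/(sech u · sech v)`.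
[cite: Tosi2026, Theorem 1 (proof device, ours)] -/
theorem one_div_one_sub_tanh_mul_tanh (u v : ℝ) :
    1 / (1 - Real.tanh u * Real.tanh v) = sech (u - v) / (sech u * sech v) := by
  have hu := (Real.cosh_pos u).ne'
  have hv := (Real.cosh_pos v).ne'
  have huv := (Real.cosh_pos (u - v)).ne'
  rw [Real.tanh_eq_sinh_div_cosh, Real.tanh_eq_sinh_div_cosh, sech, sech, sech, Real.cosh_sub]
  have hden : Real.cosh u * Real.cosh v - Real.sinh u * Real.sinh v ≠ 0 := by
    rw [← Real.cosh_sub]; exact huv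
  field_simp

/-- **The integrand transforms into the cycle density**:
`∏ sech²(a_i) · ω(tanh a) = sech(a₀) ∏_{i<n} sech(a_i − a_{i+1}) sech(a_n)`. [cite: Tosi2026, Theorem 1 (proof device, ours)] -/
theorem prod_sech_sq_mul_omegaDensity_tanhMap (n : ℕ) (a : Fin (n + 1) → ℝ) :
    (∏ i, sech (a i) ^ 2) * omegaDensity (n + 1) (tanhMap n a) = cycleDensity n a := by
  rw [omegaDensity_succ]
  have hfac : ∀ i : Fin n, 1 / (1 - tanhMap n a i.castSucc * tanhMap n a i.succ) =
      sech (a i.castSucc - a i.succ) / (sech (a i.castSucc) * sech (a i.succ)) := fun i =>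
    one_div_one_sub_tanh_mul_tanh _ _
  rw [prod_congr rfl fun i _ => hfac i, prod_div_distrib, prod_mul_distrib]
  have hsq : (∏ i, sech (a i) ^ 2) = (∏ i, sech (a i)) * ∏ i, sech (a i) := by
    rw [← prod_mul_distrib]; exact prod_congr rfl fun i _ => sq _
  have hA : ∏ i, sech (a i) = (∏ i : Fin n, sech (a i.castSucc)) * sech (a (Fin.last n)) :=
    Fin.prod_univ_castSucc _
  have hB : ∏ i, sech (a i) = sech (a 0) * ∏ i : Fin n, sech (a i.succ) := Fin.prod_univ_succ _
  rw [hsq]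
  nth_rw 1 [hA]
  rw [hB]
  have h1 : (∏ i : Fin n, sech (a i.castSucc)) ≠ 0 := prod_ne_zero_iff.mpr fun i _ => (sech_pos _).ne'
  have h2 : (∏ i : Fin n, sech (a i.succ)) ≠ 0 := prod_ne_zero_iff.mpr fun i _ => (sech_pos _).ne'
  unfold cycleDensity chainDensity
  field_simp

/-- `ω ≥ 0` on the box (each factor `1/(1 − x_i x_{i+1})` is positive there).
[cite: Tosi2026, Introduction p. 2 (definition of `ξ_l`)] -/
theorem omegaDensity_nonneg_of_mem_box (n : ℕ) {x : Fin (n + 1) → ℝ} (hx : x ∈ box (n + 1)) :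
    0 ≤ omegaDensity (n + 1) x := by
  rw [omegaDensity_succ]
  refine prod_nonneg fun i _ => ?_
  have h1 := hx i.castSucc
  have h2 := hx i.succ
  have : x i.castSucc * x i.succ < 1 := by nlinarith [h1.1, h1.2, h2.1, h2.2]
  exact div_nonneg zero_le_one (by linarith)

/-- `ω` is measurable. [cite: Tosi2026, Introduction p. 2 (definition of `ξ_l`)] -/
theorem measurable_omegaDensity_succ (n : ℕ) : Measurable (omegaDensity (n + 1)) := by
  have e : omegaDensity (n + 1) = fun x => ∏ i : Fin n, 1 / (1 - x i.castSucc * x i.succ) :=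
    funext (omegaDensity_succ n)
  rw [e]
  refine Finset.measurable_prod _ fun i _ => ?_
  exact measurable_const.div (measurable_const.sub ((measurable_pi_apply _).mul (measurable_pi_apply _)))

/-- **`ξ_{n+1}` as a `sech`-chain integral over the positive orthant**:
`ξ_{n+1} = ∫_{(0,∞)^{n+1}} sech(a₀) ∏_{i<n} sech(a_i − a_{i+1}) sech(a_n) da` (as the real part of a
lower Lebesgue integral). [cite: Tosi2026, Theorem 1 (proof device, ours)] -/
theorem xi_succ_eq_lintegral_posOrthant (n : ℕ) :
    xi (n + 1) = (∫⁻ a in posOrthant n, ENNReal.ofReal (cycleDensity n a)).toReal := by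
  unfold xi
  rw [integral_eq_lintegral_of_nonneg_ae ?_ (measurable_omegaDensity_succ n).aestronglyMeasurable]
  · congr 1
    rw [lintegral_box_eq_lintegral_posOrthant]
    refine setLIntegral_congr_fun (measurableSet_posOrthant n) (fun a _ => ?_)
    rw [← ENNReal.ofReal_mul (prod_nonneg fun i _ => sq_nonneg _), prod_sech_sq_mul_omegaDensity_tanhMap]
  · exact (ae_restrict_iff' (measurableSet_box_succ n)).mpr
      (Filter.Eventually.of_forall fun x hx => omegaDensity_nonneg_of_mem_box n hx)

/-! ### Peeling the last coordinate: the chain collapses onto the convolution powers of `sech` -/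

/-- The integrand `t ↦ sech(c − t) g(t)` is integrable for bounded measurable `g`.
[cite: Tosi2026, Theorem 1 (proof device, ours)] -/
theorem integrable_sech_sub_mul {g : ℝ → ℝ} (hg : Measurable g) {C : ℝ} (hgC : ∀ t, |g t| ≤ C) (c : ℝ) :
    Integrable fun t : ℝ => sech (c - t) * g t := by
  have h := (integrable_sech_sub c).bdd_mul (c := C) hg.aestronglyMeasurable
    (Filter.Eventually.of_forall fun t => by rw [Real.norm_eq_abs]; exact hgC t)
  refine h.congr (Filter.Eventually.of_forall fun t => ?_)
  simp [mul_comm]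

/-- Splitting the chain density at the last vertex: for `a = (a', t)`,
`chainDensity (n+1) g (snoc a' t) = chainDensity n 1̃ a' ⋯` — concretely
`= [sech(a'₀) ∏_{i<n} sech(a'_i − a'_{i+1})] · (sech(a'_n − t) g(t))`. [cite: Tosi2026, Theorem 1 (proof device, ours)] -/
theorem chainDensity_snoc (n : ℕ) (g : ℝ → ℝ) (a' : Fin (n + 1) → ℝ) (t : ℝ) :
    chainDensity (n + 1) g (Fin.snoc a' t : Fin (n + 2) → ℝ) =
      (sech (a' 0) * ∏ i : Fin n, sech (a' i.castSucc - a' i.succ)) *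
        (sech (a' (Fin.last n) - t) * g t) := by
  unfold chainDensity
  have h0 : (Fin.snoc a' t : Fin (n + 2) → ℝ) 0 = a' 0 := by simp
  have hlast : (Fin.snoc a' t : Fin (n + 2) → ℝ) (Fin.last (n + 1)) = t := Fin.snoc_last _ _
  rw [h0, hlast, Fin.prod_univ_castSucc]
  have hmid : ∀ i : Fin n,
      sech ((Fin.snoc a' t : Fin (n + 2) → ℝ) i.castSucc.castSucc -
          (Fin.snoc a' t : Fin (n + 2) → ℝ) i.castSucc.succ) = sech (a' i.castSucc - a' i.succ) := by
    intro i
    rw [Fin.snoc_castSucc, Fin.succ_castSucc, Fin.snoc_castSucc]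
  have hend : sech ((Fin.snoc a' t : Fin (n + 2) → ℝ) (Fin.last n).castSucc -
      (Fin.snoc a' t : Fin (n + 2) → ℝ) (Fin.last n).succ) = sech (a' (Fin.last n) - t) := by
    rw [Fin.snoc_castSucc, Fin.succ_last, Fin.snoc_last]
  rw [prod_congr rfl fun i _ => hmid i, hend]
  ring

/-- **Peeling the last coordinate** (Tonelli): for bounded measurable `g ≥ 0`,
`∫_{ℝ^{n+2}} chainDensity (n+1) g = ∫_{ℝ^{n+1}} chainDensity n (c ↦ ∫ sech(c − t) g(t) dt)`.
[cite: Tosi2026, Theorem 1 (proof device, ours)] -/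
theorem lintegral_chainDensity_succ (n : ℕ) {g : ℝ → ℝ} (hg : Measurable g) (hg0 : ∀ t, 0 ≤ g t)
    {C : ℝ} (hgC : ∀ t, |g t| ≤ C) :
    ∫⁻ a, ENNReal.ofReal (chainDensity (n + 1) g a) =
      ∫⁻ a', ENNReal.ofReal (chainDensity n (fun c => ∫ t, sech (c - t) * g t) a') := by
  set e := MeasurableEquiv.piFinSuccAbove (fun _ : Fin (n + 2) => ℝ) (Fin.last (n + 1)) with he_def
  have he : MeasurePreserving e := volume_preserving_piFinSuccAbove (fun _ : Fin (n + 2) => ℝ) (Fin.last (n + 1))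
  have hsymm : ∀ p : ℝ × (Fin (n + 1) → ℝ), e.symm p = (Fin.snoc p.2 p.1 : Fin (n + 2) → ℝ) := by
    intro p
    rw [he_def, MeasurableEquiv.piFinSuccAbove_symm_apply]
    funext j
    rw [Fin.insertNthEquiv_apply, Fin.insertNth_last']
  have hF : Measurable fun a : Fin (n + 2) → ℝ => ENNReal.ofReal (chainDensity (n + 1) g a) :=
    ENNReal.measurable_ofReal.comp (measurable_chainDensity (n + 1) hg)
  rw [← he.symm.lintegral_comp_emb e.symm.measurableEmbedding, Measure.volume_eq_prod,
    lintegral_prod_symm (fun p => ENNReal.ofReal (chainDensity (n + 1) g (e.symm p)))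
      (hF.comp e.symm.measurable).aemeasurable]
  refine lintegral_congr fun a' => ?_
  simp only [hsymm, chainDensity_snoc]
  set A := sech (a' 0) * ∏ i : Fin n, sech (a' i.castSucc - a' i.succ) with hA
  have hA0 : 0 ≤ A := mul_nonneg (sech_pos _).le (prod_nonneg fun i _ => (sech_pos _).le)
  have hmeas : Measurable fun t : ℝ => ENNReal.ofReal (sech (a' (Fin.last n) - t) * g t) :=
    ENNReal.measurable_ofReal.comp
      ((continuous_sech.measurable.comp (measurable_const.sub measurable_id)).mul hg)
  have hint := integrable_sech_sub_mul hg hgC (a' (Fin.last n))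
  have hnn : 0 ≤ᵐ[volume] fun t : ℝ => sech (a' (Fin.last n) - t) * g t :=
    Filter.Eventually.of_forall fun t => mul_nonneg (sech_pos _).le (hg0 t)
  calc ∫⁻ t, ENNReal.ofReal (A * (sech (a' (Fin.last n) - t) * g t))
      = ∫⁻ t, ENNReal.ofReal A * ENNReal.ofReal (sech (a' (Fin.last n) - t) * g t) := by
        refine lintegral_congr fun t => ?_
        rw [ENNReal.ofReal_mul hA0]
    _ = ENNReal.ofReal A * ∫⁻ t, ENNReal.ofReal (sech (a' (Fin.last n) - t) * g t) :=
        lintegral_const_mul _ hmeas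
    _ = ENNReal.ofReal A * ENNReal.ofReal (∫ t, sech (a' (Fin.last n) - t) * g t) := by
        rw [ofReal_integral_eq_lintegral_ofReal hint hnn]
    _ = ENNReal.ofReal (chainDensity n (fun c => ∫ t, sech (c - t) * g t) a') := by
        rw [← ENNReal.ofReal_mul hA0]
        rfl

/-- The one-dimensional chain: `∫_{ℝ^1} sech(a₀) g(a₀) = ∫_ℝ sech(0 − t) g(t) dt`.
[cite: Tosi2026, Theorem 1 (proof device, ours)] -/
theorem lintegral_chainDensity_zero {g : ℝ → ℝ} (hg : Measurable g) (hg0 : ∀ t, 0 ≤ g t)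
    {C : ℝ} (hgC : ∀ t, |g t| ≤ C) :
    ∫⁻ a, ENNReal.ofReal (chainDensity 0 g a) = ENNReal.ofReal (∫ t, sech (0 - t) * g t) := by
  have he := volume_preserving_funUnique (Fin 1) ℝ
  have hF : (fun a : Fin (0 + 1) → ℝ => ENNReal.ofReal (chainDensity 0 g a)) =
      fun a => ENNReal.ofReal (sech (0 - a 0) * g (a 0)) := by
    funext a
    simp only [chainDensity, Fin.prod_univ_zero, mul_one, Fin.last_zero, zero_sub, sech_neg]
  rw [hF]
  have h := he.lintegral_comp_emb (MeasurableEquiv.funUnique (Fin 1) ℝ).measurableEmbedding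
    (fun x : ℝ => ENNReal.ofReal (sech (0 - x) * g x))
  simp only [MeasurableEquiv.funUnique_apply, Fin.default_eq_zero] at h
  rw [ofReal_integral_eq_lintegral_ofReal (integrable_sech_sub_mul hg hgC 0)
    (Filter.Eventually.of_forall fun t => mul_nonneg (sech_pos _).le (hg0 t))]
  exact h

/-- **The chain collapses onto the convolution powers**: for every `n, k`,
`∫_{ℝ^{n+1}} sech(a₀) ∏_{i<n} sech(a_i − a_{i+1}) f_k(a_n) da = f_{n+k+1}(0)`, `f_k = sech^{*(k+1)}`.
[cite: Tosi2026, Theorem 1 (proof device, ours)] -/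
theorem lintegral_chainDensity_sechConv : ∀ (n k : ℕ),
    ∫⁻ a, ENNReal.ofReal (chainDensity n (sechConv k) a) = ENNReal.ofReal (sechConv (n + k + 1) 0)
  | 0, k => by
      rw [lintegral_chainDensity_zero (measurable_sechConv k) (sechConv_nonneg k)
        (C := π ^ k) (fun t => by rw [abs_of_nonneg (sechConv_nonneg k t)]; exact sechConv_le k t)]
      rw [zero_add, sechConv_succ]
  | n + 1, k => by
      rw [lintegral_chainDensity_succ n (measurable_sechConv k) (sechConv_nonneg k)
        (C := π ^ k) (fun t => by rw [abs_of_nonneg (sechConv_nonneg k t)]; exact sechConv_le k t)]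
      have e : (fun c : ℝ => ∫ t, sech (c - t) * sechConv k t) = sechConv (k + 1) := by
        funext c; rw [sechConv_succ]
      rw [e, lintegral_chainDensity_sechConv n (k + 1)]
      congr 2
      ring

/-- In particular `∫_{ℝ^{n+1}} sech(a₀) ∏_{i<n} sech(a_i − a_{i+1}) sech(a_n) da = f_{n+1}(0) = sech^{*(n+2)}(0)`.
[cite: Tosi2026, Theorem 1 (proof device, ours)] -/
theorem lintegral_cycleDensity (n : ℕ) :
    ∫⁻ a, ENNReal.ofReal (cycleDensity n a) = ENNReal.ofReal (sechConv (n + 1) 0) := by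
  have h := lintegral_chainDensity_sechConv n 0
  rw [sechConv_zero, add_zero] at h
  exact h

end Literature.NumberTheory.Irrationality.Tosi2026
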